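import Literature.Topology.FourManifolds.HCobordismThetaFiniteKM
import Literature.Topology.FourManifolds.HomotopySpheresGroupLeaves
import HarnessLib

/-!
# `Θₙ` is finite (Kervaire–Milnor 1963, Thm. 1.2): the three printed leaves Thm. 4.1, Thm. 5.1, Thm. 8.5 named, and the assembly

Topic `Literature/Topology/FourManifolds`. Fact-decomposition record (librarian, fact-decompose,
2026-08-16) for the named fact `Literature.Topology.FourManifolds.finite_homotopySphereClass`
(spc4.S13, `HCobordism.lean`: `Θₙ = HomotopySphereClass n` is finite for every `n ≠ 4`;
M. Kervaire, J. Milnor, *Groups of homotopy spheres I*, Ann. of Math. 77 (1963), Thm. 1.2), an XL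
fact that ran to the prover budget cap. Its proof files (`HCobordismThetaFinite.lean`,
`HCobordismThetaFiniteKM.lean`, `…KMSurgery.lean`, `…KMMiddle.lean`) prove Kervaire–Milnor's own
reduction (p. 512: "`Θₙ / bPₙ₊₁` is finite (§4) … `bPₙ₊₁` is zero for `n` even (§§5, 6), and is
finite cyclic for `n` odd, `n ≠ 3` (§§7, 8)", plus the low dimensions and Perelman for `n = 3`) as
the theorem `finite_homotopySphereClass_of_kervaireMilnor_printed_leaves`, whose hypotheses are
four named facts of the tree — Thm. 1.1 (`exists_commGroup_homotopySphereClass_of_ne_three`,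
the corrected form for `n ≠ 0, 3, 4`, bridged to the older binder by
`exists_commGroup_homotopySphereClass_of_ne_three_of_three` with Perelman's theorem), Smale's
h-cobordism theorem (`nonempty_diffeomorph_of_isHCobordant_of_five_le`, spc4.S15), Cor. 7.6
(`HomotopySphereClass.isCyclic_bP_four_mul`), Perelman (`nonempty_diffeomorph_sphere_three`) — and
THREE printed theorems of the paper which were so far un-named hypotheses. They are named here,
verbatim in the binder shapes of that theorem:

* `KervaireMilnor1963_quotient_bP_finite` — **Thm. 4.1** (p. 510): "The quotient group `Θₙ / bPₙ₊₁`
  is finite" (`n ≥ 5`; proof pp. 510–512: the Pontryagin–Thom construction `p : Θₙ → Πₙ / p(Sⁿ)`,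
  Lemmas 4.2–4.5, and Serre's finiteness of the stable stem `Πₙ`; the algebra of Lemma 4.5 and of
  the last paragraph is PROVED in `HCobordismThetaFiniteKM.lean`, namespace `ThetaModBP`);
* `KervaireMilnor1963_boundsContractible_of_boundsStablyParallelizable_even` — **Thm. 5.1**
  (p. 512): "If a homotopy sphere of dimension `2k` bounds an s-parallelizable manifold `M`, then it
  bounds a contractible manifold `M₁`" (here for `2k ≥ 6`, the range the assembly uses; proof
  §§5–6: framed surgery below the middle dimension), i.e. `bP₂ₖ₊₁ = 0` in manifold form;
* `KervaireMilnor1963_bP_card_le_two_of_mod_four_eq_one` — **Thm. 8.5** (p. 536): for `n = 4m + 1`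
  (`n ≥ 5`) the group `bPₙ₊₁ = bP₄ₘ₊₂` "is either zero or cyclic of order `2`" (proof §8: the Arf
  (Kervaire) invariant of an s-parallelizable `(4m+2)`-manifold bounded by a homotopy sphere).

The assembly `finite_homotopySphereClass_holds_of` is
`finite_homotopySphereClass_of_kervaireMilnor_printed_leaves` with the three leaves named; the deeper
proved reductions of the same files (`…_section4_leaves`, `…_frontier…`: Thm. 4.1 from Serre's
theorem and the Pontryagin–Thom facts; Thm. 5.1 / 8.5 from the surgery lemmas) are available to the
provers of the three children.

## References

* [KervaireMilnorAnnals1963] M. Kervaire, J. Milnor, *Groups of homotopy spheres I*, Ann. of Math.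
  77 (1963) 504–537: Thm. 1.1, Thm. 1.2 (p. 504), Remark p. 505, Lemma 2.3 (p. 506), Thm. 4.1 and
  Lemmas 4.2–4.5 (pp. 510–512), Thm. 5.1 (p. 512), Cor. 7.6 (p. 530), Thm. 8.5 (p. 536).
* [MilnorHCobordism1965] J. Milnor, *Lectures on the h-cobordism theorem* (1965), Thm. 9.1.
* [MorganTian2007] J. Morgan, G. Tian, *Ricci flow and the Poincaré conjecture* (2007), Cor. 0.2 (a).
-/

noncomputable section

open scoped Manifold ContDiff

namespace Literature.Topology.FourManifolds

/-! ### The three printed leaves, named -/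

/-- **Kervaire–Milnor 1963, Thm. 4.1 (p. 510): "The quotient group `Θₙ / bPₙ₊₁` is finite"**, for
`n ≥ 5`, in the tree's vocabulary: for every `IsMul`-compatible commutative group structure on
`Θₙ = HomotopySphereClass n` (the connected-sum group of Thm. 1.1, cf.
`exists_commGroup_homotopySphereClass`) and every subgroup `H` whose underlying set is
`bP n = bPₙ₊₁` (the classes of homotopy spheres bounding parallelizable manifolds, §4), the quotient
`Θₙ ⧸ H` is finite. Printed proof (pp. 510–512): `p'(Σ) = p(Σ) mod p(Sⁿ)` is a homomorphism
`Θₙ → Πₙ / p(Sⁿ)` (Lemma 4.5) with kernel `bPₙ₊₁` (Lemma 4.2), and the stable stem `Πₙ = πₙ₊ₖ(Sᵏ)`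
is finite (Serre). The binder shape is the one consumed by
`finite_homotopySphereClass_of_kervaireMilnor_printed_leaves` (`HCobordismThetaFiniteKM.lean`).
[cite: KervaireMilnorAnnals1963, Thm. 4.1 (p. 510), Lemmas 4.2–4.5 and the end of its proof (pp. 510–512)] -/
def KervaireMilnor1963_quotient_bP_finite : Prop :=
  ∀ n : ℕ, 5 ≤ n → ∀ [CommGroup (HomotopySphereClass n)],
    (∀ a b c : HomotopySphereClass n, HomotopySphereClass.IsMul a b c → a * b = c) →
      ∀ H : Subgroup (HomotopySphereClass n),
        (H : Set (HomotopySphereClass n)) = HomotopySphereClass.bP n →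
          Finite (HomotopySphereClass n ⧸ H)

/-- **Kervaire–Milnor 1963, Thm. 5.1 (p. 512): "If a homotopy sphere of dimension `2k` bounds an
s-parallelizable manifold `M`, then it bounds a contractible manifold `M₁`"** — here for `2k ≥ 6`
(the range used for `Θₙ`, `n ≥ 5`), in the tree's vocabulary: for a homotopy `n`-sphere `S`
(`HomotopySphere n`), `n ≥ 5` even, and a null-cobordism `c` of its carrier whose bounding manifold
`c.W` is stably parallelizable (`IsStablyParallelizable (𝓡∂ (n + 1)) c.W`), the carrier bounds a
compact contractible manifold (`BoundsContractible n S.carrier`). This is `bP₂ₖ₊₁ = 0` in manifold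
form; the class-level consequence `(bP n).Subsingleton` follows with Lemma 2.3 and Smale's theorem
(`HomotopySphereClass.subsingleton_bP_of_boundsContractible`, `HCobordismThetaFiniteKM.lean`). Printed
proof: §5 (`k` even) and §6 (`k` odd), framed spherical modifications of `M` killing its homotopy
groups up to the middle dimension (Lemma 5.2–5.6, Lemma 6.1–6.5).
[cite: KervaireMilnorAnnals1963, Thm. 5.1 (p. 512), §5 and §6] -/
def KervaireMilnor1963_boundsContractible_of_boundsStablyParallelizable_even : Prop :=
  ∀ n : ℕ, 5 ≤ n → Even n → ∀ (S : HomotopySphere n) (c : NullCobordism n S.carrier),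
    IsStablyParallelizable (𝓡∂ (n + 1)) c.W → BoundsContractible n S.carrier

/-- **Kervaire–Milnor 1963, Thm. 8.5 (p. 536): for `k` odd the group `bP₂ₖ` "is either zero or
cyclic of order `2`"** — here for `2k = n + 1` with `n = 4m + 1 ≥ 5`, in the tree's vocabulary: for
every `IsMul`-compatible commutative group structure on `Θₙ` there is a subgroup `H` with
underlying set `bP n = bPₙ₊₁` which is finite of order at most `2`. Printed proof, §8: an
s-parallelizable `(4m+2)`-manifold bounded by a homotopy sphere can be surgered to a contractible
one iff its Arf–Kervaire invariant vanishes (Lemma 8.3–8.4, Thm. 8.5); the binder shape is the one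
consumed by `finite_homotopySphereClass_of_kervaireMilnor_printed_leaves`.
[cite: KervaireMilnorAnnals1963, Thm. 8.5 (p. 536) and §8] -/
def KervaireMilnor1963_bP_card_le_two_of_mod_four_eq_one : Prop :=
  ∀ n : ℕ, 5 ≤ n → n % 4 = 1 → ∀ [CommGroup (HomotopySphereClass n)],
    (∀ a b c : HomotopySphereClass n, HomotopySphereClass.IsMul a b c → a * b = c) →
      ∃ H : Subgroup (HomotopySphereClass n),
        (H : Set (HomotopySphereClass n)) = HomotopySphereClass.bP n ∧ Finite H ∧ Nat.card H ≤ 2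

/-! ### The assembly -/

/-- **spc4.S13 (`Θₙ` finite for `n ≠ 4`) from its seven named leaves** (fact-decomposition glue,
canonical name; Kervaire–Milnor's reduction p. 512): Thm. 4.1, Thm. 5.1 (manifold form, `n ≥ 5`
even), Thm. 8.5 (this file), Thm. 1.1 in its corrected form for `n ≠ 0, 3, 4`
(`exists_commGroup_homotopySphereClass_of_ne_three`, `HomotopySpheresGroupLeaves.lean`),
Smale's h-cobordism theorem (`nonempty_diffeomorph_of_isHCobordant_of_five_le`), Cor. 7.6
(`HomotopySphereClass.isCyclic_bP_four_mul`) and Perelman's theorem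
(`nonempty_diffeomorph_sphere_three`); dimensions `0, 1, 2` are theorems of the tree. This is
`finite_homotopySphereClass_of_kervaireMilnor_printed_leaves` (`HCobordismThetaFiniteKM.lean`).
[cite: KervaireMilnorAnnals1963, Thm. 1.2 (p. 504), Thm. 4.1 (p. 510), Thm. 5.1 (p. 512), Cor. 7.6 (p. 530), Thm. 8.5 (p. 536) and the reduction p. 512]
[cite: MilnorHCobordism1965, Thm. 9.1] [cite: MorganTian2007, Cor. 0.2 (a)] -/
theorem finite_homotopySphereClass_holds_of
    (h41 : KervaireMilnor1963_quotient_bP_finite)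
    (h51 : KervaireMilnor1963_boundsContractible_of_boundsStablyParallelizable_even)
    (h85 : KervaireMilnor1963_bP_card_le_two_of_mod_four_eq_one)
    (hG : exists_commGroup_homotopySphereClass_of_ne_three)
    (hS15 : nonempty_diffeomorph_of_isHCobordant_of_five_le.{0})
    (h76 : HomotopySphereClass.isCyclic_bP_four_mul)
    (h3 : nonempty_diffeomorph_sphere_three.{0}) : finite_homotopySphereClass :=
  finite_homotopySphereClass_of_kervaireMilnor_printed_leaves
    (exists_commGroup_homotopySphereClass_of_ne_three_of_three hG h3) hS15 h41 h51 h76 h85 h3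

end Literature.Topology.FourManifolds

end
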